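import Summits.Ventures.HodgeRepro2.T5SchurIsotypicCopy

/-!
# T5SchurIsotypicUnique — (A3) STEP 4: a representation meets only one isotypic part

Cell pub-hodge-repro2, seat p5, Tier 5 (route/T5-N4-p5.md, N4.3 (A3) STEP 4, l. 147): «If
A_{π′} ≠ 0 as well with π′ ≇ π, then π₀|_{G_∞} is also a Hilbert sum of copies of π′; a copy of π
inside it is then a closed G_∞-invariant subspace of a Hilbert sum of copies of π′, hence by (δ) a
Hilbert sum of copies of π′ — an irreducible one, so π ≅ π′: contradiction.»  The prose went through
(δ)'s commutant; this file proves the same conclusion from [Bo72] 5.5 alone (T5SchurIsotypicCopy):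

* `exists_linearIsometryEquiv_of_range_le`: if `σ` is irreducible unitary and `T : F →L[ℂ] E` is a
  non-zero intertwiner into `ρ` whose range lies in the closed span of closed `ρ`-stable subspaces
  `H' j` each unitarily equivalent to the irreducible `σ'`, then `σ ≅ σ'` (a coordinate projection
  `P_j` is non-zero on the range, `U'_j⁻¹ ∘ P_j ∘ T` is a non-zero intertwiner between irreducibles,
  and `T5SchurIntertwiner.exists_linearIsometryEquiv_of_ne_zero` applies);
* `exists_linearIsometryEquiv_of_equiv` (STEP 4): if a non-zero closed `ρ`-stable `W` inside the
  closed span of copies of `σ` is `ρ`-equivalent to a closed `ρ`-stable `W'` inside the closed span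
  of copies of `σ'` (`Φ : W ≃ₗᵢ[ℂ] W'` intertwining the restrictions), then `σ ≅ σ'`.  Reading:
  `W ≅ π₀ ≅ W'` are the two images of `π₀` in `L_π` and `L_{π′}` given by non-zero `A_π`, `A_{π′}`
  through 5.5 (`T5SchurIntertwiner.exists_linearIsometryEquiv_range`); the conclusion `π ≅ π′` is
  the contradiction of STEP 4, so `π₀` meets exactly one isotypic part.

* `isOrtho_of_not_equiv`, `isOrtho_closure_iSup_of_not_equiv` (STEP 3 (β)): copies of inequivalent
  irreducibles are orthogonal, hence so are the closed spans `L_π ⊥ L_{π′}` — «the orthogonal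
  projection of a copy of π onto a copy of π′ is an element of R(π, π′), which by 5.5 would exhibit
  π as a subrepresentation of the irreducible π′ if non-zero; so it is zero».

Mathlib only besides the p5 files.  Axioms: propext, Classical.choice, Quot.sound.
-/

namespace Summit.Ventures.HodgeRepro2.T5SchurIsotypicUnique

open ContinuousLinearMap
open scoped InnerProductSpace

variable {E F F' : Type*} [NormedAddCommGroup E] [InnerProductSpace ℂ E] [CompleteSpace E]
  [NormedAddCommGroup F] [InnerProductSpace ℂ F] [CompleteSpace F]
  [NormedAddCommGroup F'] [InnerProductSpace ℂ F'] [CompleteSpace F']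
variable {G : Type*} [Group G]

/-- **A non-zero intertwiner from an irreducible `σ` into the closed span of copies of an irreducible
`σ'` forces `σ ≅ σ'`.** -/
theorem exists_linearIsometryEquiv_of_range_le {ρ : G →* (E →L[ℂ] E)}
    (hρ : ∀ g, star (ρ g) = ρ g⁻¹)
    {σ : G →* (F →L[ℂ] F)} (hσ : ∀ g, star (σ g) = σ g⁻¹)
    (hσirr : ∀ V : Submodule ℂ F, IsClosed (V : Set F) →
      (∀ g, ∀ v ∈ V, σ g v ∈ V) → V = ⊥ ∨ V = ⊤)
    {σ' : G →* (F' →L[ℂ] F')} (hσ' : ∀ g, star (σ' g) = σ' g⁻¹)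
    (hσ'irr : ∀ V : Submodule ℂ F', IsClosed (V : Set F') →
      (∀ g, ∀ v ∈ V, σ' g v ∈ V) → V = ⊥ ∨ V = ⊤)
    {ι : Type*} (H : ι → Submodule ℂ E) (hHc : ∀ i, IsClosed (H i : Set E))
    (hHs : ∀ i g, ∀ x ∈ H i, ρ g x ∈ H i)
    (U : ∀ i, F' ≃ₗᵢ[ℂ] H i) (hU : ∀ i g x, ((U i) (σ' g x) : E) = ρ g (U i x))
    (T : F →L[ℂ] E) (hT : ∀ g, T ∘L σ g = ρ g ∘L T) (hT0 : T ≠ 0)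
    (hTle : ∀ x, T x ∈ (⨆ i, H i).topologicalClosure) :
    ∃ (t : ℝ) (V : F ≃ₗᵢ[ℂ] F'), 0 < t ∧ ∀ g x, V (σ g x) = σ' g (V x) := by
  obtain ⟨x, hx⟩ := T5SchurIntertwiner.exists_apply_ne_zero hT0
  obtain ⟨i, hi⟩ := T5SchurIsotypicCopy.exists_starProjection_ne_zero H hHc (hTle x) hx
  haveI : CompleteSpace (H i) := (hHc i).completeSpace_coe
  -- the intertwiner `A = U_i⁻¹ ∘ P_i ∘ T : F → F'`
  let P : E →L[ℂ] H i :=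
    (H i).starProjection.codRestrict (H i) fun y => (H i).starProjection_apply_mem y
  let A : F →L[ℂ] F' := (U i).symm.toLinearIsometry.toContinuousLinearMap ∘L (P ∘L T)
  have hA : ∀ g, A ∘L σ g = σ' g ∘L A := by
    intro g
    ext y
    simp only [A, comp_apply, LinearIsometry.coe_toContinuousLinearMap,
      LinearIsometryEquiv.coe_toLinearIsometry]
    rw [T5SchurIsotypicCopy.symm_apply_eq (hHs i) (U i) (hU i) g]
    congr 1
    apply Subtype.ext
    have hTy := DFunLike.congr_fun (hT g) y
    simp only [comp_apply] at hTy
    have hcomm :=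
      DFunLike.congr_fun (T5SchurIff.starProjection_comm hρ (hHc i) (hHs i) g) (T y)
    simp only [comp_apply] at hcomm
    simp only [P, coe_codRestrict_apply]
    rw [hTy, hcomm]
  have hA0 : A ≠ 0 := by
    intro h
    have hy := DFunLike.congr_fun h x
    simp only [A, P, comp_apply, LinearIsometry.coe_toContinuousLinearMap,
      LinearIsometryEquiv.coe_toLinearIsometry, zero_apply,
      LinearIsometryEquiv.map_eq_zero_iff] at hy
    exact hi (congrArg Subtype.val hy)
  obtain ⟨t, V, ht, -, hV⟩ :=
    T5SchurIntertwiner.exists_linearIsometryEquiv_of_ne_zero hσ hσ' hσirr hσ'irr hA hA0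
  exact ⟨t, V, ht, hV⟩

/-- **(A3) STEP 4.**  A non-zero closed `ρ`-stable subspace `W` of the closed span of copies of the
irreducible `σ`, unitarily `ρ`-equivalent (via `Φ`) to a closed `ρ`-stable subspace `W'` of the closed
span of copies of the irreducible `σ'`, forces `σ ≅ σ'`: a representation meets only one isotypic
part. -/
theorem exists_linearIsometryEquiv_of_equiv {ρ : G →* (E →L[ℂ] E)}
    (hρ : ∀ g, star (ρ g) = ρ g⁻¹)
    {σ : G →* (F →L[ℂ] F)} (hσ : ∀ g, star (σ g) = σ g⁻¹)
    (hσirr : ∀ V : Submodule ℂ F, IsClosed (V : Set F) →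
      (∀ g, ∀ v ∈ V, σ g v ∈ V) → V = ⊥ ∨ V = ⊤)
    {σ' : G →* (F' →L[ℂ] F')} (hσ' : ∀ g, star (σ' g) = σ' g⁻¹)
    (hσ'irr : ∀ V : Submodule ℂ F', IsClosed (V : Set F') →
      (∀ g, ∀ v ∈ V, σ' g v ∈ V) → V = ⊥ ∨ V = ⊤)
    {ι : Type*} (H : ι → Submodule ℂ E) (hHc : ∀ i, IsClosed (H i : Set E))
    (hHs : ∀ i g, ∀ x ∈ H i, ρ g x ∈ H i)
    (U : ∀ i, F ≃ₗᵢ[ℂ] H i) (hU : ∀ i g x, ((U i) (σ g x) : E) = ρ g (U i x))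
    {ι' : Type*} (H' : ι' → Submodule ℂ E) (hH'c : ∀ j, IsClosed (H' j : Set E))
    (hH's : ∀ j g, ∀ x ∈ H' j, ρ g x ∈ H' j)
    (U' : ∀ j, F' ≃ₗᵢ[ℂ] H' j) (hU' : ∀ j g x, ((U' j) (σ' g x) : E) = ρ g (U' j x))
    {W W' : Submodule ℂ E} (hWc : IsClosed (W : Set E))
    (hWle : W ≤ (⨆ i, H i).topologicalClosure) (hW'le : W' ≤ (⨆ j, H' j).topologicalClosure)
    (hW0 : W ≠ ⊥)
    (ρW : G →* (W →L[ℂ] W)) (hρW : ∀ g (w : W), (ρW g w : E) = ρ g w)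
    (ρW' : G →* (W' →L[ℂ] W')) (hρW' : ∀ g (w : W'), (ρW' g w : E) = ρ g w)
    (Φ : W ≃ₗᵢ[ℂ] W') (hΦ : ∀ g x, Φ (ρW g x) = ρW' g (Φ x)) :
    ∃ (t : ℝ) (V : F ≃ₗᵢ[ℂ] F'), 0 < t ∧ ∀ g x, V (σ g x) = σ' g (V x) := by
  obtain ⟨T₀, hT₀0, hT₀⟩ :=
    T5SchurIsotypicCopy.exists_intertwiner_ne_zero hρ hσ H hHc hHs U hU hWc hWle hW0 ρW hρW
  -- transport along `Φ` and embed in `E`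
  let T : F →L[ℂ] E := W'.subtypeL ∘L (Φ.toLinearIsometry.toContinuousLinearMap ∘L T₀)
  have hT : ∀ g, T ∘L σ g = ρ g ∘L T := by
    intro g
    ext y
    simp only [T, comp_apply, Submodule.subtypeL_apply, LinearIsometry.coe_toContinuousLinearMap,
      LinearIsometryEquiv.coe_toLinearIsometry]
    have h1 := DFunLike.congr_fun (hT₀ g) y
    simp only [comp_apply] at h1
    rw [h1, hΦ, hρW']
  have hT0 : T ≠ 0 := by
    intro h
    apply hT₀0
    ext y
    have hy := DFunLike.congr_fun h y
    simp only [T, comp_apply, Submodule.subtypeL_apply, LinearIsometry.coe_toContinuousLinearMap,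
      LinearIsometryEquiv.coe_toLinearIsometry, zero_apply, Submodule.coe_eq_zero,
      LinearIsometryEquiv.map_eq_zero_iff] at hy
    rw [hy, zero_apply]
  have hTle : ∀ y, T y ∈ (⨆ j, H' j).topologicalClosure := fun y => hW'le (Φ (T₀ y)).2
  exact exists_linearIsometryEquiv_of_range_le hρ hσ hσirr hσ' hσ'irr H' hH'c hH's U' hU' T hT hT0
    hTle

/-- **(A3) STEP 3 (β).**  Copies of two inequivalent irreducible unitary representations inside
`ρ` are orthogonal: the orthogonal projection of the copy of `σ` onto the copy of `σ'` is an
intertwiner, which by 5.5 would make `σ ≅ σ'` if non-zero. -/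
theorem isOrtho_of_not_equiv {ρ : G →* (E →L[ℂ] E)} (hρ : ∀ g, star (ρ g) = ρ g⁻¹)
    {σ : G →* (F →L[ℂ] F)} (hσ : ∀ g, star (σ g) = σ g⁻¹)
    (hσirr : ∀ V : Submodule ℂ F, IsClosed (V : Set F) →
      (∀ g, ∀ v ∈ V, σ g v ∈ V) → V = ⊥ ∨ V = ⊤)
    {σ' : G →* (F' →L[ℂ] F')} (hσ' : ∀ g, star (σ' g) = σ' g⁻¹)
    (hσ'irr : ∀ V : Submodule ℂ F', IsClosed (V : Set F') →
      (∀ g, ∀ v ∈ V, σ' g v ∈ V) → V = ⊥ ∨ V = ⊤)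
    {H H' : Submodule ℂ E} (hH'c : IsClosed (H' : Set E)) (hH's : ∀ g, ∀ x ∈ H', ρ g x ∈ H')
    (U : F ≃ₗᵢ[ℂ] H) (hU : ∀ g x, (U (σ g x) : E) = ρ g (U x))
    (U' : F' ≃ₗᵢ[ℂ] H') (hU' : ∀ g x, (U' (σ' g x) : E) = ρ g (U' x))
    (hne : ∀ V : F ≃ₗᵢ[ℂ] F', ¬ ∀ g x, V (σ g x) = σ' g (V x)) : H ⟂ H' := by
  haveI : CompleteSpace H' := hH'c.completeSpace_coe
  rw [Submodule.isOrtho_iff_le]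
  intro x hx
  by_contra hxo
  have hPx : H'.starProjection x ≠ 0 := fun h =>
    hxo ((Submodule.starProjection_apply_eq_zero_iff H').mp h)
  -- `T = P_{H'} ∘ U : F → E`, a non-zero intertwiner with range in `H'`
  let T : F →L[ℂ] E :=
    H'.starProjection ∘L (H.subtypeL ∘L U.toLinearIsometry.toContinuousLinearMap)
  have hT : ∀ g, T ∘L σ g = ρ g ∘L T := by
    intro g
    ext y
    simp only [T, comp_apply, Submodule.subtypeL_apply, LinearIsometry.coe_toContinuousLinearMap,
      LinearIsometryEquiv.coe_toLinearIsometry]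
    rw [hU]
    have := DFunLike.congr_fun (T5SchurIff.starProjection_comm hρ hH'c hH's g) (U y : E)
    simpa only [comp_apply] using this
  have hT0 : T ≠ 0 := by
    intro h
    have hy := DFunLike.congr_fun h (U.symm ⟨x, hx⟩)
    simp only [T, comp_apply, Submodule.subtypeL_apply, LinearIsometry.coe_toContinuousLinearMap,
      LinearIsometryEquiv.coe_toLinearIsometry, LinearIsometryEquiv.apply_symm_apply,
      zero_apply] at hy
    exact hPx hy
  have hTle : ∀ y, T y ∈ (⨆ _ : Unit, H').topologicalClosure := fun y => by
    apply Submodule.le_topologicalClosure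
    rw [iSup_const]
    exact H'.starProjection_apply_mem _
  obtain ⟨t, V, ht, hV⟩ := exists_linearIsometryEquiv_of_range_le hρ hσ hσirr hσ' hσ'irr
    (fun _ : Unit => H') (fun _ => hH'c) (fun _ => hH's) (fun _ => U') (fun _ => hU') T hT hT0 hTle
  exact hne V hV

omit [CompleteSpace E] in
/-- Orthogonal subspaces have orthogonal closures. -/
theorem isOrtho_topologicalClosure {U V : Submodule ℂ E} (h : U ⟂ V) :
    U.topologicalClosure ⟂ V.topologicalClosure := by
  rw [Submodule.isOrtho_iff_le] at h ⊢
  rw [Submodule.orthogonal_closure]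
  exact Submodule.topologicalClosure_minimal U h V.isClosed_orthogonal

/-- **(A3) STEP 3 (β), «L_π ⊥ L_{π′} for π ≇ π′».**  The closed spans of the copies of two
inequivalent irreducible unitary representations are orthogonal. -/
theorem isOrtho_closure_iSup_of_not_equiv {ρ : G →* (E →L[ℂ] E)}
    (hρ : ∀ g, star (ρ g) = ρ g⁻¹)
    {σ : G →* (F →L[ℂ] F)} (hσ : ∀ g, star (σ g) = σ g⁻¹)
    (hσirr : ∀ V : Submodule ℂ F, IsClosed (V : Set F) →
      (∀ g, ∀ v ∈ V, σ g v ∈ V) → V = ⊥ ∨ V = ⊤)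
    {σ' : G →* (F' →L[ℂ] F')} (hσ' : ∀ g, star (σ' g) = σ' g⁻¹)
    (hσ'irr : ∀ V : Submodule ℂ F', IsClosed (V : Set F') →
      (∀ g, ∀ v ∈ V, σ' g v ∈ V) → V = ⊥ ∨ V = ⊤)
    {ι : Type*} (H : ι → Submodule ℂ E)
    (U : ∀ i, F ≃ₗᵢ[ℂ] H i) (hU : ∀ i g x, ((U i) (σ g x) : E) = ρ g (U i x))
    {ι' : Type*} (H' : ι' → Submodule ℂ E) (hH'c : ∀ j, IsClosed (H' j : Set E))
    (hH's : ∀ j g, ∀ x ∈ H' j, ρ g x ∈ H' j)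
    (U' : ∀ j, F' ≃ₗᵢ[ℂ] H' j) (hU' : ∀ j g x, ((U' j) (σ' g x) : E) = ρ g (U' j x))
    (hne : ∀ V : F ≃ₗᵢ[ℂ] F', ¬ ∀ g x, V (σ g x) = σ' g (V x)) :
    (⨆ i, H i).topologicalClosure ⟂ (⨆ j, H' j).topologicalClosure := by
  apply isOrtho_topologicalClosure
  rw [Submodule.isOrtho_iSup_left]
  intro i
  rw [Submodule.isOrtho_iSup_right]
  intro j
  exact isOrtho_of_not_equiv hρ hσ hσirr hσ' hσ'irr (hH'c j) (hH's j) (U i) (hU i) (U' j) (hU' j)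
    hne

end Summit.Ventures.HodgeRepro2.T5SchurIsotypicUnique
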